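import Summits.Parity.GeneralizedHardyLittlewood.Theses.GoldbachHeathBrownDispersion
import Literature.NumberTheory.Sieve.HeathBrownCubicPrimesHolds
import Literature.NumberTheory.Sieve.HeathBrownMorozClassFamily
import HarnessLib

/-!
# Crux `HeathBrownMorozUniform` (stmt-Parity-19915): the class Type II block, every large exponent, η-band form

Helper (`--supports stmt-Parity-19915`) of the coset port of Heath-Brown's theorem to residue classes (campaign
map attached to the item; objects `CubicSieve.classPairs`, `classKappa` of `HeathBrownMorozClassFamily`): the
class analogue of the tree's `CubicSieve.HeathBrown2001_typeII_terms_allLargeC` ([HeathBrownActa2001, (3.15),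
p. 21]) with (i) the class family and `κ_d = (w(d)/d²)κ`; (ii) the class versions of Lemma 3.7 (𝒜-side),
3.9, 3.10 (= HBM04 Lemma 3.3, Lemma 4.1, Prop. 4.2 (ii)) as HYPOTHESES `h37A`, `h39`, `h310` — the campaign's
stubs (`h37A` is the tree's `CubicSieve.HeathBrownMoroz2004_lemma_3_3`; kept as a hypothesis to decouple files);
(3.14) is asked up to `d·Q₁` (the unit split of the coset Type II merges a congruence mod `d` into (3.14)) and
supplied by Lemma 3.8 at exponent `A + 1`; (iii) `η` FREE in the band `(log X)^{-c} ≤ η ≤ K_b(log X)^{-c}`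
(the crux's boxes are Heath-Brown boxes at height `dX'` with `η = (log(X/d))^{-c}`, inside the band with
`K_b = 2^c`): the exact-power steps of the tree proof become `η^{1/2} ≤ K_b^{1/2}(log X)^{-c/2}`,
`η² ≥ (log X)^{-2c}`, and the threshold is `c₀ = 2c_* + 8`. Main result: `classTypeII_terms_band`.
[cite: HeathBrownActa2001, §3 (3.15) and p. 21] [cite: HeathBrownMoroz2004, §5]. Tree: the tools of
`HeathBrown2001_typeII_terms_allLargeC` (`eventually_typeII_params`, `indexCount_le_log`, `dyadicTop_add_one_le`,
`dyadic_levels`, `abs_sum_sub_mul_sum_le`, `abs_sub_mul_le_three`, index counts), `HeathBrown2001_lemma_3_7_holds`,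
`HeathBrown2001_lemma_3_8_holds`, `classKappa_def`, `classWeight_pos`.
-/

noncomputable section

open Polynomial NumberField Finset Filter Topology Asymptotics

namespace Summit.Parity.GeneralizedHardyLittlewood.Theorems.GoldbachHeathBrownDispersionHeathBrownMorozUniform

open Literature.NumberTheory.Sieve.CubicSieve Literature.NumberTheory.Sieve.CubicPrimes
open Literature.NumberTheory.LFunctions.CubeRootTwoField

/-- Hypothesis (3.14) is monotone in its range: `Hyp314` up to `Q₁'` gives it up to any `Q₁ ≤ Q₁'`. [folklore] -/
theorem hyp314_mono {X τ : ℝ} {k : ℕ} {m : Fin k → ℕ} {Q₁ Q₁' C₁ c₁ c₃ c₄ : ℝ} (hQ : Q₁ ≤ Q₁')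
    (h : Hyp314 X τ m Q₁' C₁ c₁ c₃ c₄) : Hyp314 X τ m Q₁ C₁ c₁ c₃ c₄ :=
  fun q hq hqQ => h q hq (hqQ.trans hQ)

/-- Eventually in `X` (for fixed `c > 0`, `Kb`, `d`): `Kb·(log X)^{-c} ≤ 1/10` and `d ≤ log X`. [folklore] -/
theorem eventually_band_params {c : ℝ} (hc : 0 < c) (Kb : ℝ) (d : ℕ) :
    ∀ᶠ X : ℝ in atTop, Kb * Real.log X ^ (-c) ≤ 1 / 10 ∧ (d : ℝ) ≤ Real.log X := by
  have hη : Tendsto (fun X : ℝ => Kb * Real.log X ^ (-c)) atTop (𝓝 (Kb * 0)) :=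
    ((tendsto_rpow_neg_atTop hc).comp Real.tendsto_log_atTop).const_mul Kb
  rw [mul_zero] at hη
  filter_upwards [hη.eventually (ge_mem_nhds (by norm_num : (0 : ℝ) < 1 / 10)),
    Real.tendsto_log_atTop.eventually (eventually_ge_atTop (d : ℝ))] with X h1 h3
  exact ⟨h1, h3⟩

set_option maxHeartbeats 1600000 in
/-- **The class Type II block, every large exponent, η-band form.** For the class family
`classPairs X η d a b` (`d ≥ 1`) with comparison constant `κ_d`, assume the class versions of the
𝒜-side of Lemma 3.7 (`h37A`), of Lemma 3.9 (`h39`) and of Lemma 3.10 with (3.14) up to `d·Q₁` (`h310`).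
Then for the limit `σ₀` of the singular series there is `c₀ > 0` such that for every `c ≥ c₀` and `K_b ≥ 1`
there are `C, X₀` with: for `X ≥ X₀` and every `η` with `(log X)^{-c} ≤ η ≤ K_b(log X)^{-c}`, the five Type II
groups of the class Lemma 3.4 total `≤ C τη²X²/log X` (`τ = (log log X)^{-1/6}`).
[cite: HeathBrownActa2001, §3 (3.15) and p. 21] -/
theorem classTypeII_terms_band (d a b : ℕ) (hd : 1 ≤ d)
    (h37A : ∀ ϖ : ℝ, 0 < ϖ → ϖ < 1 / 5 →
      ∃ C X₀ : ℝ, ∀ X η : ℝ, X₀ ≤ X → Real.exp (-Real.log X ^ (1 / 3 : ℝ)) ≤ η → η ≤ 1 →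
        (∑ n ∈ Icc 3 (chainBound (hbTau ϖ X)),
            |(Upiece (classPairs X η d a b) pairIdeal X (hbTau ϖ X) n : ℝ) -
              Uhat X (hbTau ϖ X) (classPairs X η d a b) pairIdeal n| ≤
          C * (hbXi (hbTau ϖ X) / hbTau ϖ X ^ 4) * (η ^ 2 * X ^ 2 / Real.log X)) ∧
        (|(U1piece (classPairs X η d a b) pairIdeal X (hbTau ϖ X) 1 : ℝ) -
            Uhat X (hbTau ϖ X) (classPairs X η d a b) pairIdeal 1| ≤
          C * (hbXi (hbTau ϖ X) / hbTau ϖ X ^ 4) * (η ^ 2 * X ^ 2 / Real.log X)) ∧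
        (|(U1piece (classPairs X η d a b) pairIdeal X (hbTau ϖ X) 2 : ℝ) -
            Uhat X (hbTau ϖ X) (classPairs X η d a b) pairIdeal 2| ≤
          C * (hbXi (hbTau ϖ X) / hbTau ϖ X ^ 4) * (η ^ 2 * X ^ 2 / Real.log X)) ∧
        (|(S₄ (classPairs X η d a b) pairIdeal X (hbTau ϖ X) : ℝ) -
            S4hat X (hbTau ϖ X) (classPairs X η d a b) pairIdeal| ≤
          C * (hbXi (hbTau ϖ X) / hbTau ϖ X ^ 4) * (η ^ 2 * X ^ 2 / Real.log X)) ∧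
        (|(U2one (classPairs X η d a b) pairIdeal X (hbTau ϖ X) : ℝ) -
            U2hat X (hbTau ϖ X) (classPairs X η d a b) pairIdeal| ≤
          C * (hbXi (hbTau ϖ X) / hbTau ϖ X ^ 4) * (η ^ 2 * X ^ 2 / Real.log X)))
    (h39 : ∀ σ₀ : ℝ, Tendsto singularProductPartial atTop (𝓝 σ₀) →
      ∀ ϖ : ℝ, 0 < ϖ → ϖ < 1 / 5 →
        ∃ c C X₀ : ℝ, ∀ X η : ℝ, X₀ ≤ X → Real.exp (-Real.log X ^ (1 / 3 : ℝ)) ≤ η → η ≤ 1 →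
          ∀ (k : ℕ) (m : Fin k → ℕ), CoreAdmissible (hbTau ϖ X) m →
            ∀ cR : Ideal (𝓞 K) → ℝ, CSupport X (hbTau ϖ X) cR →
              |bilin (classPairs X η d a b) pairIdeal cR (eWeight X (hbTau ϖ X) m) -
                  classKappa σ₀ X η d *
                    bilin (normWindow X η) (fun J => J) cR (dWeight X (hbTau ϖ X) m)| ≤
                C * (∏ i, (m i : ℝ))⁻¹ * η ^ (5 / 2 : ℝ) * X ^ 2 * Real.log X ^ c)
    (h310 : ∀ ϖ : ℝ, 0 < ϖ → ϖ < 1 / 5 →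
      ∃ c c₃ c₄ : ℝ, 0 < c₃ ∧ 0 < c₄ ∧ ∀ C₁ c₁ c₅ c₆ : ℝ, 0 < c₁ → 0 < c₅ → 0 < c₆ →
        ∃ C X₀ : ℝ, ∀ X η Q₁ : ℝ, X₀ ≤ X → Real.exp (-Real.log X ^ (1 / 3 : ℝ)) ≤ η → η ≤ 1 →
          1 ≤ Q₁ → (d : ℝ) * Q₁ ≤ Real.exp (Real.log X ^ (1 / 3 : ℝ)) →
            (∀ (k' : ℕ) (m' : Fin k' → ℕ), CoreAdmissible (hbTau ϖ X) m' →
              Hyp314 X (hbTau ϖ X) m' ((d : ℝ) * Q₁) C₁ c₁ c₃ c₄) →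
              ∀ (k : ℕ) (m : Fin k → ℕ), CoreAdmissible (hbTau ϖ X) m →
                ∀ cR : Ideal (𝓞 K) → ℝ, CSupport X (hbTau ϖ X) cR →
                  ∀ V : ℝ, c₅ * X ^ (1 + hbTau ϖ X) ≤ V → V ≤ c₆ * X ^ (3 / 2 - hbTau ϖ X) →
                    |bilin (classPairs X η d a b) pairIdeal cR
                        (fun S => if V < (Ideal.absNorm S : ℝ) ∧ (Ideal.absNorm S : ℝ) ≤ 2 * V then
                          fWeight X (hbTau ϖ X) m S else 0)| ≤
                      C * X ^ 2 * Q₁ ^ (-(1 / 160 : ℝ)) * Real.log X ^ c) :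
    ∀ σ₀ : ℝ, Tendsto singularProductPartial atTop (𝓝 σ₀) →
      ∃ c₀ : ℝ, 0 < c₀ ∧ ∀ c : ℝ, c₀ ≤ c → ∀ Kb : ℝ, 1 ≤ Kb → ∃ C X₀ : ℝ, ∀ X η : ℝ, X₀ ≤ X →
        Real.log X ^ (-c) ≤ η → η ≤ Kb * Real.log X ^ (-c) →
        |(U1piece (classPairs X η d a b) pairIdeal X (hbTau (1 / 6) X) 1 : ℝ) -
            classKappa σ₀ X η d * U1piece (normWindow X η) (fun J => J) X (hbTau (1 / 6) X) 1|
        + |(U1piece (classPairs X η d a b) pairIdeal X (hbTau (1 / 6) X) 2 : ℝ) -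
            classKappa σ₀ X η d * U1piece (normWindow X η) (fun J => J) X (hbTau (1 / 6) X) 2|
        + ∑ n ∈ Icc 3 (chainBound (hbTau (1 / 6) X)),
            |(Upiece (classPairs X η d a b) pairIdeal X (hbTau (1 / 6) X) n : ℝ) -
              classKappa σ₀ X η d * Upiece (normWindow X η) (fun J => J) X (hbTau (1 / 6) X) n|
        + |(U2one (classPairs X η d a b) pairIdeal X (hbTau (1 / 6) X) : ℝ) -
            classKappa σ₀ X η d * U2one (normWindow X η) (fun J => J) X (hbTau (1 / 6) X)|
        + |(S₄ (classPairs X η d a b) pairIdeal X (hbTau (1 / 6) X) : ℝ) -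
            classKappa σ₀ X η d * S₄ (normWindow X η) (fun J => J) X (hbTau (1 / 6) X)| ≤
          C * hbTau (1 / 6) X * η ^ 2 * X ^ 2 / Real.log X := by
  intro σ₀ hσ
  have hσ0 : 0 ≤ σ₀ := ge_of_tendsto' hσ fun N => (singularProductPartial_pos N).le
  obtain ⟨C₇, X₇, H7⟩ := HeathBrown2001_lemma_3_7_holds (1 / 6) (by norm_num) (by norm_num)
  obtain ⟨C₇A, X₇A, H7A⟩ := h37A (1 / 6) (by norm_num) (by norm_num)
  obtain ⟨c₉, C₉, X₉, H9⟩ := h39 σ₀ hσ (1 / 6) (by norm_num) (by norm_num)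
  obtain ⟨c₁₀, c₃, c₄, hc₃, hc₄, H10⟩ := h310 (1 / 6) (by norm_num) (by norm_num)
  set cs := max (max c₉ c₁₀) 0 with hcs
  have hcs0 : 0 ≤ cs := le_max_right _ _
  have hc₉cs : c₉ ≤ cs := (le_max_left _ _).trans (le_max_left _ _)
  have hc₁₀cs : c₁₀ ≤ cs := (le_max_right _ _).trans (le_max_left _ _)
  refine ⟨2 * cs + 8, by linarith, fun cη hcη Kb hK => ?_⟩
  have hcη0 : 0 < cη := by linarith
  set A := 160 * (2 * cη + cs + 4) with hAdef
  have hA0 : 0 < A := by rw [hAdef]; linarith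
  have hA1 : 0 < A + 1 := by linarith
  obtain ⟨C₁, c₁, X₈, hc₁, H8⟩ := HeathBrown2001_lemma_3_8_holds (1 / 6) (by norm_num) (by norm_num) (A + 1) c₃ c₄ hA1 hc₃ hc₄
  obtain ⟨C₁₀, X₁₀, H10'⟩ := H10 C₁ c₁ (1 / 2) 1 hc₁ (by norm_num) (by norm_num)
  obtain ⟨X₀, hX₀⟩ := eventually_atTop.mp ((eventually_typeII_params hcη0 hA1).and
    ((eventually_band_params hcη0 Kb d).and
    ((eventually_ge_atTop X₇).and ((eventually_ge_atTop X₇A).and ((eventually_ge_atTop X₈).and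
      ((eventually_ge_atTop X₉).and (eventually_ge_atTop X₁₀)))))))
  set w : ℝ := classWeight d with hw
  have hwpos : 0 < w := classWeight_pos d
  refine ⟨5 * (|C₇A| + |C₇| * (w * σ₀ / 3)) + 5 * (|C₉| * Kb ^ (1 / 2 : ℝ) + |C₁₀|), X₀, fun X η hX hηlo hηhi => ?_⟩
  obtain ⟨⟨hX2, hL8, hM, hη00, -, h21, hτ0, hτ4, hτL, -, hQexp⟩, ⟨hK10, hdL⟩, hX7, hX7A, hX8, hX9, hX10⟩ :=
    hX₀ X hX
  set L := Real.log X with hL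
  set η₀ := L ^ (-cη) with hη₀def
  set τ := hbTau (1 / 6) X with hτdef
  set κ := classKappa σ₀ X η d with hκ
  set Q₁ := L ^ A with hQ₁
  have hX1 : 1 < X := by linarith
  have hX0 : 0 < X := by linarith
  have hLpos : 0 < L := by linarith
  have hL1 : 1 ≤ L := by linarith
  have hK0 : 0 < Kb := by linarith
  have hη0 : 0 < η := lt_of_lt_of_le hη00 hηlo
  have hη1 : η ≤ 1 := by linarith
  have h21η : Real.exp (-L ^ (1 / 3 : ℝ)) ≤ η := h21.trans hηlo
  have hκ0 : 0 ≤ κ := by rw [hκ]; exact classKappa_nonneg hσ0 hX0.le hη0.le d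
  have hτ1 : τ ≤ 1 := by linarith
  have hd0 : (0 : ℝ) < d := by exact_mod_cast hd
  have hQ₁1 : 1 ≤ Q₁ := Real.one_le_rpow hL1 hA0.le
  have hdQ : (d : ℝ) * Q₁ ≤ L ^ (A + 1) := by
    rw [Real.rpow_add hLpos, Real.rpow_one, mul_comm]
    exact mul_le_mul_of_nonneg_left hdL (by positivity)
  have hdQexp : (d : ℝ) * Q₁ ≤ Real.exp (L ^ (1 / 3 : ℝ)) := hdQ.trans hQexp
  obtain ⟨-, -, -, -, -, h7UB, h7U1B, h7U2B, h7S4B, h7VB⟩ := H7 X η hX7 h21η hη1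
  obtain ⟨h7U, h7U1, h7U2, h7S4, h7V⟩ := H7A X η hX7A h21η hη1
  have h9 := H9 X η hX9 h21η hη1
  have h8 : ∀ (k' : ℕ) (m' : Fin k' → ℕ), CoreAdmissible τ m' → Hyp314 X τ m' ((d : ℝ) * Q₁) C₁ c₁ c₃ c₄ :=
    fun k' m' hm' => hyp314_mono hdQ (H8 X hX8 k' m' hm')
  have h10 := H10' X η Q₁ hX10 h21η hη1 hQ₁1 hdQexp h8
  set B₉ := |C₉| * η ^ (5 / 2 : ℝ) * X ^ 2 * L ^ cs with hB₉
  set B₁₀ := |C₁₀| * X ^ 2 * Q₁ ^ (-(1 / 160 : ℝ)) * L ^ cs with hB₁₀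
  set Bp := B₉ + ((dyadicTop X τ : ℕ) + 1) * B₁₀ with hBp
  have hQ₁pos : 0 < Q₁ := by positivity
  have hB₉0 : 0 ≤ B₉ := by positivity
  have hB₁₀0 : 0 ≤ B₁₀ := by positivity
  have hBp0 : 0 ≤ Bp := by positivity
  have piece : ∀ (k : ℕ) (m : Fin k → ℕ), CoreAdmissible τ m → ∀ c : Ideal (𝓞 K) → ℝ,
      CSupport X τ c →
        |bilin (classPairs X η d a b) pairIdeal c (dWeight X τ m) -
            κ * bilin (normWindow X η) (fun J => J) c (dWeight X τ m)| ≤ Bp := by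
    intro k m hm c hc
    have hk := length_pos_of_coreAdmissible hτ0 hm
    obtain ⟨hlev, htop⟩ := dyadic_levels hX1 hτ4
    obtain ⟨hlo, hhi⟩ := rpow_bounds_of_coreAdmissible hX1.le hτ0 hm
    have hV₀ : 0 < X ^ (1 + τ) / 2 := by positivity
    have hsupp : ∀ S, fWeight X τ m S ≠ 0 →
        X ^ (1 + τ) / 2 < (Ideal.absNorm S : ℝ) ∧
          (Ideal.absNorm S : ℝ) ≤ 2 ^ (dyadicTop X τ + 1) * (X ^ (1 + τ) / 2) := by
      intro S hS
      obtain ⟨h1, h2⟩ := absNorm_mem_of_fWeight_ne_zero hX0 hk hS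
      have hP : 0 < X ^ (1 + τ) := Real.rpow_pos_of_pos hX0 _
      exact ⟨by linarith, by linarith⟩
    rw [bilin_dWeight_eq X τ (classPairs X η d a b) pairIdeal c m,
      bilin_dyadic (classPairs X η d a b) pairIdeal c hV₀ (dyadicTop X τ) (fWeight X τ m) hsupp]
    have h9' : |bilin (classPairs X η d a b) pairIdeal c (eWeight X τ m) -
        κ * bilin (normWindow X η) (fun J => J) c (dWeight X τ m)| ≤ B₉ := by
      refine (h9 k m hm c hc).trans ?_
      have hM1 := one_le_prod_of_coreAdmissible hτ0 hτ1 hm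
      have hMinv : (∏ i, (m i : ℝ))⁻¹ ≤ 1 := inv_le_one_of_one_le₀ hM1
      have hLc : L ^ c₉ ≤ L ^ cs := Real.rpow_le_rpow_of_exponent_le hL1 hc₉cs
      have hrest : 0 ≤ (∏ i, (m i : ℝ))⁻¹ * η ^ (5 / 2 : ℝ) * X ^ 2 * L ^ c₉ := by positivity
      calc C₉ * (∏ i, (m i : ℝ))⁻¹ * η ^ (5 / 2 : ℝ) * X ^ 2 * L ^ c₉
          = C₉ * ((∏ i, (m i : ℝ))⁻¹ * η ^ (5 / 2 : ℝ) * X ^ 2 * L ^ c₉) := by ring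
        _ ≤ |C₉| * ((∏ i, (m i : ℝ))⁻¹ * η ^ (5 / 2 : ℝ) * X ^ 2 * L ^ c₉) :=
            mul_le_mul_of_nonneg_right (le_abs_self _) hrest
        _ ≤ |C₉| * (1 * η ^ (5 / 2 : ℝ) * X ^ 2 * L ^ cs) := by gcongr
        _ = B₉ := by rw [hB₉]; ring
    have h10' : ∀ j ≤ dyadicTop X τ, |bilin (classPairs X η d a b) pairIdeal c
        (fun S => if 2 ^ j * (X ^ (1 + τ) / 2) < (Ideal.absNorm S : ℝ) ∧
            (Ideal.absNorm S : ℝ) ≤ 2 * (2 ^ j * (X ^ (1 + τ) / 2)) then fWeight X τ m S else 0)| ≤ B₁₀ := by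
      intro j hj
      obtain ⟨hVlo, hVhi⟩ := (dyadic_levels hX1 hτ4).1 j hj
      refine (h10 k m hm c hc _ hVlo hVhi).trans ?_
      have hLc : L ^ c₁₀ ≤ L ^ cs := Real.rpow_le_rpow_of_exponent_le hL1 hc₁₀cs
      have hrest : 0 ≤ X ^ 2 * Q₁ ^ (-(1 / 160 : ℝ)) * L ^ c₁₀ := by positivity
      calc C₁₀ * X ^ 2 * Q₁ ^ (-(1 / 160 : ℝ)) * L ^ c₁₀
          = C₁₀ * (X ^ 2 * Q₁ ^ (-(1 / 160 : ℝ)) * L ^ c₁₀) := by ring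
        _ ≤ |C₁₀| * (X ^ 2 * Q₁ ^ (-(1 / 160 : ℝ)) * L ^ c₁₀) :=
            mul_le_mul_of_nonneg_right (le_abs_self _) hrest
        _ ≤ |C₁₀| * (X ^ 2 * Q₁ ^ (-(1 / 160 : ℝ)) * L ^ cs) := by gcongr
        _ = B₁₀ := by rw [hB₁₀]; ring
    have hsum : |∑ j ∈ range (dyadicTop X τ + 1), bilin (classPairs X η d a b) pairIdeal c
        (fun S => if 2 ^ j * (X ^ (1 + τ) / 2) < (Ideal.absNorm S : ℝ) ∧
            (Ideal.absNorm S : ℝ) ≤ 2 * (2 ^ j * (X ^ (1 + τ) / 2)) then fWeight X τ m S else 0)| ≤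
        ((dyadicTop X τ : ℕ) + 1) * B₁₀ := by
      refine (abs_sum_le_sum_abs _ _).trans ?_
      calc _ ≤ ∑ _j ∈ range (dyadicTop X τ + 1), B₁₀ :=
            sum_le_sum fun j hj => h10' j (Nat.lt_succ_iff.mp (mem_range.mp hj))
        _ = ((dyadicTop X τ : ℕ) + 1) * B₁₀ := by rw [sum_const, card_range, nsmul_eq_mul]; push_cast; ring
    calc _ = |(bilin (classPairs X η d a b) pairIdeal c (eWeight X τ m) -
                κ * bilin (normWindow X η) (fun J => J) c (dWeight X τ m)) +
              ∑ j ∈ range (dyadicTop X τ + 1), bilin (classPairs X η d a b) pairIdeal c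
                (fun S => if 2 ^ j * (X ^ (1 + τ) / 2) < (Ideal.absNorm S : ℝ) ∧
                  (Ideal.absNorm S : ℝ) ≤ 2 * (2 ^ j * (X ^ (1 + τ) / 2)) then fWeight X τ m S else 0)| := by
            ring_nf
      _ ≤ _ := (abs_add_le _ _).trans (add_le_add h9' hsum)
  have gU : ∀ n, |Uhat X τ (classPairs X η d a b) pairIdeal n -
      κ * Uhat X τ (normWindow X η) (fun J => J) n| ≤ #(mIndexU τ n) * Bp := by
    intro n
    unfold Uhat
    refine (abs_sum_sub_mul_sum_le _ _ _ (fun _ => Bp) κ fun m hm => ?_).trans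
      (by rw [sum_const, nsmul_eq_mul])
    have hmU := (mem_mIndexU_iff hτ0).mp hm
    exact piece (n + 1) m hmU.1 _ (cSupport_cCoef (rpow_tau_le_rpow_last hX1.le hτ0 hmU.1))
  have gS4 : |S4hat X τ (classPairs X η d a b) pairIdeal - κ * S4hat X τ (normWindow X η) (fun J => J)| ≤
      #(mIndexCore τ 1) * Bp := by
    unfold S4hat
    refine (abs_sum_sub_mul_sum_le _ _ _ (fun _ => Bp) κ fun m hm => ?_).trans
      (by rw [sum_const, nsmul_eq_mul])
    have hmc := (mem_mIndexCore_iff hτ0).mp hm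
    exact piece 1 m hmc _ (cSupport_cCoef (rpow_tau_le_rpow_last (n := 0) hX1.le hτ0 hmc))
  have gV : |U2hat X τ (classPairs X η d a b) pairIdeal - κ * U2hat X τ (normWindow X η) (fun J => J)| ≤
      (∑ nn ∈ nPairs τ, ∑ n ∈ range (u2Bound τ + 1), (#(mIndexU2 τ n nn.2) : ℝ)) * Bp := by
    unfold U2hat
    rw [sum_mul]
    refine abs_sum_sub_mul_sum_le _ _ _ _ κ fun nn hnn => ?_
    rw [sum_mul]
    refine abs_sum_sub_mul_sum_le _ _ _ _ κ fun n _ => ?_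
    refine (abs_sum_sub_mul_sum_le _ _ _ (fun _ => Bp) κ fun m hm => ?_).trans
      (by rw [sum_const, nsmul_eq_mul])
    obtain ⟨hmc, -⟩ := (mem_mIndexU2_iff hτ0).mp hm
    obtain ⟨h₂, h₁₂, -, -⟩ := mem_nPairs hnn
    exact piece _ m hmc _ (cSupport_c2Coef hX1.le hτ0 h₂ h₁₂.le)
  have hN : (indexCount τ : ℝ) ≤ L := indexCount_le_log hLpos hM
  have hJ : ((dyadicTop X τ : ℕ) : ℝ) + 1 ≤ L := dyadicTop_add_one_le hL8 hτ0.le hτ4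
  have hNBp : (indexCount τ : ℝ) * Bp ≤ L * B₉ + L * L * B₁₀ := by
    calc (indexCount τ : ℝ) * Bp ≤ L * Bp := mul_le_mul_of_nonneg_right hN hBp0
      _ = L * B₉ + L * (((dyadicTop X τ : ℕ) : ℝ) + 1) * B₁₀ := by rw [hBp]; ring
      _ ≤ L * B₉ + L * L * B₁₀ := by gcongr
  have gU' : ∀ n ≤ 2, |Uhat X τ (classPairs X η d a b) pairIdeal n -
      κ * Uhat X τ (normWindow X η) (fun J => J) n| ≤ L * B₉ + L * L * B₁₀ := fun n hn =>
    (gU n).trans ((mul_le_mul_of_nonneg_right (card_mIndexU_le_indexCount τ hn) hBp0).trans hNBp)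
  have gS4' : |S4hat X τ (classPairs X η d a b) pairIdeal - κ * S4hat X τ (normWindow X η) (fun J => J)| ≤
      L * B₉ + L * L * B₁₀ :=
    gS4.trans ((mul_le_mul_of_nonneg_right (card_mIndexCore_one_le_indexCount τ) hBp0).trans hNBp)
  have gV' : |U2hat X τ (classPairs X η d a b) pairIdeal - κ * U2hat X τ (normWindow X η) (fun J => J)| ≤
      L * B₉ + L * L * B₁₀ :=
    gV.trans ((mul_le_mul_of_nonneg_right (sum_card_mIndexU2_le τ) hBp0).trans hNBp)
  have gUsum : ∑ n ∈ Icc 3 (chainBound τ), |Uhat X τ (classPairs X η d a b) pairIdeal n -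
      κ * Uhat X τ (normWindow X η) (fun J => J) n| ≤ L * B₉ + L * L * B₁₀ := by
    calc _ ≤ ∑ n ∈ Icc 3 (chainBound τ), (#(mIndexU τ n) : ℝ) * Bp := sum_le_sum fun n _ => gU n
      _ = (∑ n ∈ Icc 3 (chainBound τ), (#(mIndexU τ n) : ℝ)) * Bp := by rw [sum_mul]
      _ ≤ (indexCount τ : ℝ) * Bp := mul_le_mul_of_nonneg_right (sum_card_mIndexU_le hτ0) hBp0
      _ ≤ _ := hNBp
  set W := τ * η ^ 2 * X ^ 2 / L with hW
  have hW0 : 0 ≤ W := by positivity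
  have hξτ : hbXi τ / τ ^ 4 = τ := by rw [hbXi, div_eq_iff (pow_ne_zero 4 hτ0.ne')]; ring
  have hEA : C₇A * (hbXi τ / τ ^ 4) * (η ^ 2 * X ^ 2 / L) ≤ |C₇A| * W := by
    rw [hξτ, hW, show C₇A * τ * (η ^ 2 * X ^ 2 / L) = C₇A * (τ * η ^ 2 * X ^ 2 / L) by ring]
    exact mul_le_mul_of_nonneg_right (le_abs_self _) hW0
  have hκle : κ ≤ w * (σ₀ * η / (3 * X)) := by
    rw [hκ, classKappa_def, kappa_def, hw]
    have hd1 : (1 : ℝ) ≤ (d : ℝ) ^ 2 := one_le_pow₀ (by exact_mod_cast hd)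
    have : classWeight d / (d : ℝ) ^ 2 ≤ classWeight d := div_le_self hwpos.le hd1
    exact mul_le_mul_of_nonneg_right this (by positivity)
  have hEB : κ * (C₇ * (hbXi τ / τ ^ 4) * (η * X ^ 3 / L)) ≤ |C₇| * (w * σ₀ / 3) * W := by
    rw [hξτ]
    have h1 : κ * (C₇ * τ * (η * X ^ 3 / L)) ≤ κ * (|C₇| * τ * (η * X ^ 3 / L)) :=
      mul_le_mul_of_nonneg_left (by gcongr; exact le_abs_self _) hκ0
    have h2 : κ * (|C₇| * τ * (η * X ^ 3 / L)) ≤ (w * (σ₀ * η / (3 * X))) * (|C₇| * τ * (η * X ^ 3 / L)) :=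
      mul_le_mul_of_nonneg_right hκle (by positivity)
    have h3 : (w * (σ₀ * η / (3 * X))) * (|C₇| * τ * (η * X ^ 3 / L)) = |C₇| * (w * σ₀ / 3) * W := by
      rw [hW]; field_simp
    linarith
  have hLB₉ : L * B₉ ≤ |C₉| * Kb ^ (1 / 2 : ℝ) * W := by
    -- `η^{5/2} = η²·η^{1/2}`, `η^{1/2} ≤ Kb^{1/2} L^{-cη/2}`, `L^{1+cs-cη/2} ≤ L^{-2}`, `L^{-1} ≤ τ`
    have hη52 : η ^ (5 / 2 : ℝ) = η ^ 2 * η ^ (1 / 2 : ℝ) := by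
      rw [show (5 / 2 : ℝ) = (2 : ℕ) + (1 / 2 : ℝ) by norm_num, Real.rpow_add hη0, Real.rpow_natCast]
    have hηhalf : η ^ (1 / 2 : ℝ) ≤ Kb ^ (1 / 2 : ℝ) * L ^ (-cη / 2) := by
      calc η ^ (1 / 2 : ℝ) ≤ (Kb * η₀) ^ (1 / 2 : ℝ) := Real.rpow_le_rpow hη0.le hηhi (by norm_num)
        _ = Kb ^ (1 / 2 : ℝ) * η₀ ^ (1 / 2 : ℝ) := Real.mul_rpow hK0.le hη00.le
        _ = Kb ^ (1 / 2 : ℝ) * L ^ (-cη / 2) := by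
            rw [hη₀def, ← Real.rpow_mul hLpos.le]; ring_nf
    have hexp : L * L ^ (-cη / 2) * L ^ cs ≤ L⁻¹ * L⁻¹ := by
      rw [show L * L ^ (-cη / 2) * L ^ cs = L ^ (1 : ℝ) * L ^ (-cη / 2) * L ^ cs by rw [Real.rpow_one],
        ← Real.rpow_add hLpos, ← Real.rpow_add hLpos, ← Real.rpow_neg_one, ← Real.rpow_add hLpos]
      exact Real.rpow_le_rpow_of_exponent_le hL1 (by linarith)
    have hK12 : 0 ≤ Kb ^ (1 / 2 : ℝ) := Real.rpow_nonneg hK0.le _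
    have key : L * η ^ (1 / 2 : ℝ) * L ^ cs ≤ Kb ^ (1 / 2 : ℝ) * (L⁻¹ * τ) := by
      calc L * η ^ (1 / 2 : ℝ) * L ^ cs ≤ L * (Kb ^ (1 / 2 : ℝ) * L ^ (-cη / 2)) * L ^ cs := by gcongr
        _ = Kb ^ (1 / 2 : ℝ) * (L * L ^ (-cη / 2) * L ^ cs) := by ring
        _ ≤ Kb ^ (1 / 2 : ℝ) * (L⁻¹ * L⁻¹) := mul_le_mul_of_nonneg_left hexp hK12
        _ ≤ Kb ^ (1 / 2 : ℝ) * (L⁻¹ * τ) := by gcongr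
    calc L * B₉ = |C₉| * (η ^ 2 * X ^ 2) * (L * η ^ (1 / 2 : ℝ) * L ^ cs) := by rw [hB₉, hη52]; ring
      _ ≤ |C₉| * (η ^ 2 * X ^ 2) * (Kb ^ (1 / 2 : ℝ) * (L⁻¹ * τ)) := by gcongr
      _ = |C₉| * Kb ^ (1 / 2 : ℝ) * W := by rw [hW]; field_simp
  have hLB₁₀ : L * L * B₁₀ ≤ |C₁₀| * W := by
    have hQpow : Q₁ ^ (-(1 / 160 : ℝ)) = L ^ (A * (-(1 / 160))) := by
      rw [hQ₁, ← Real.rpow_mul hLpos.le]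
    have hexp : L * L * Q₁ ^ (-(1 / 160 : ℝ)) * L ^ cs = L ^ (-2 * cη) * L⁻¹ * L⁻¹ := by
      rw [hQpow, ← Real.rpow_neg_one, ← Real.rpow_add hLpos, ← Real.rpow_add hLpos,
        show L * L * L ^ (A * (-(1 / 160))) * L ^ cs =
          L ^ (1 : ℝ) * L ^ (1 : ℝ) * L ^ (A * (-(1 / 160))) * L ^ cs by rw [Real.rpow_one],
        ← Real.rpow_add hLpos, ← Real.rpow_add hLpos, ← Real.rpow_add hLpos]
      congr 1; rw [hAdef]; ring
    have hη2 : L ^ (-2 * cη) ≤ η ^ 2 := by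
      have : L ^ (-2 * cη) = η₀ ^ 2 := by
        rw [hη₀def, ← Real.rpow_natCast, ← Real.rpow_mul hLpos.le]; ring_nf
      rw [this]
      exact pow_le_pow_left₀ hη00.le hηlo 2
    calc L * L * B₁₀ = |C₁₀| * X ^ 2 * (L * L * Q₁ ^ (-(1 / 160 : ℝ)) * L ^ cs) := by rw [hB₁₀]; ring
      _ = |C₁₀| * X ^ 2 * (L ^ (-2 * cη) * L⁻¹ * L⁻¹) := by rw [hexp]
      _ ≤ |C₁₀| * X ^ 2 * (η ^ 2 * τ * L⁻¹) := by gcongr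
      _ = |C₁₀| * W := by rw [hW]; field_simp
  have hII : L * B₉ + L * L * B₁₀ ≤ (|C₉| * Kb ^ (1 / 2 : ℝ) + |C₁₀|) * W := by linarith
  have tU1 := abs_sub_mul_le_three (U1piece (classPairs X η d a b) pairIdeal X τ 1 : ℝ)
    (U1piece (normWindow X η) (fun J => J) X τ 1 : ℝ) (Uhat X τ (classPairs X η d a b) pairIdeal 1)
    (Uhat X τ (normWindow X η) (fun J => J) 1) κ hκ0
  have tU2 := abs_sub_mul_le_three (U1piece (classPairs X η d a b) pairIdeal X τ 2 : ℝ)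
    (U1piece (normWindow X η) (fun J => J) X τ 2 : ℝ) (Uhat X τ (classPairs X η d a b) pairIdeal 2)
    (Uhat X τ (normWindow X η) (fun J => J) 2) κ hκ0
  have tS4 := abs_sub_mul_le_three (S₄ (classPairs X η d a b) pairIdeal X τ : ℝ)
    (S₄ (normWindow X η) (fun J => J) X τ : ℝ) (S4hat X τ (classPairs X η d a b) pairIdeal)
    (S4hat X τ (normWindow X η) (fun J => J)) κ hκ0
  have tV := abs_sub_mul_le_three (U2one (classPairs X η d a b) pairIdeal X τ : ℝ)
    (U2one (normWindow X η) (fun J => J) X τ : ℝ) (U2hat X τ (classPairs X η d a b) pairIdeal)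
    (U2hat X τ (normWindow X η) (fun J => J)) κ hκ0
  have tU : ∑ n ∈ Icc 3 (chainBound τ), |(Upiece (classPairs X η d a b) pairIdeal X τ n : ℝ) -
      κ * Upiece (normWindow X η) (fun J => J) X τ n| ≤
      ∑ n ∈ Icc 3 (chainBound τ), |(Upiece (classPairs X η d a b) pairIdeal X τ n : ℝ) -
          Uhat X τ (classPairs X η d a b) pairIdeal n| +
        κ * ∑ n ∈ Icc 3 (chainBound τ), |(Upiece (normWindow X η) (fun J => J) X τ n : ℝ) -
          Uhat X τ (normWindow X η) (fun J => J) n| +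
        ∑ n ∈ Icc 3 (chainBound τ), |Uhat X τ (classPairs X η d a b) pairIdeal n -
          κ * Uhat X τ (normWindow X η) (fun J => J) n| := by
    rw [mul_sum, ← sum_add_distrib, ← sum_add_distrib]
    exact sum_le_sum fun n _ => abs_sub_mul_le_three _ _ _ _ κ hκ0
  have e1 := h7U1.trans hEA
  have e2 := h7U2.trans hEA
  have e3 := h7U.trans hEA
  have e4 := h7V.trans hEA
  have e5 := h7S4.trans hEA
  have f1 : κ * |(U1piece (normWindow X η) (fun J => J) X τ 1 : ℝ) -
      Uhat X τ (normWindow X η) (fun J => J) 1| ≤ |C₇| * (w * σ₀ / 3) * W :=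
    (mul_le_mul_of_nonneg_left h7U1B hκ0).trans hEB
  have f2 : κ * |(U1piece (normWindow X η) (fun J => J) X τ 2 : ℝ) -
      Uhat X τ (normWindow X η) (fun J => J) 2| ≤ |C₇| * (w * σ₀ / 3) * W :=
    (mul_le_mul_of_nonneg_left h7U2B hκ0).trans hEB
  have f3 : κ * ∑ n ∈ Icc 3 (chainBound τ), |(Upiece (normWindow X η) (fun J => J) X τ n : ℝ) -
      Uhat X τ (normWindow X η) (fun J => J) n| ≤ |C₇| * (w * σ₀ / 3) * W :=
    (mul_le_mul_of_nonneg_left h7UB hκ0).trans hEB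
  have f4 : κ * |(U2one (normWindow X η) (fun J => J) X τ : ℝ) -
      U2hat X τ (normWindow X η) (fun J => J)| ≤ |C₇| * (w * σ₀ / 3) * W :=
    (mul_le_mul_of_nonneg_left h7VB hκ0).trans hEB
  have f5 : κ * |(S₄ (normWindow X η) (fun J => J) X τ : ℝ) -
      S4hat X τ (normWindow X η) (fun J => J)| ≤ |C₇| * (w * σ₀ / 3) * W :=
    (mul_le_mul_of_nonneg_left h7S4B hκ0).trans hEB
  have hgoal : (5 * (|C₇A| + |C₇| * (w * σ₀ / 3)) + 5 * (|C₉| * Kb ^ (1 / 2 : ℝ) + |C₁₀|)) * τ * η ^ 2 * X ^ 2 / L =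
      (5 * (|C₇A| + |C₇| * (w * σ₀ / 3)) + 5 * (|C₉| * Kb ^ (1 / 2 : ℝ) + |C₁₀|)) * W := by
    rw [hW]; ring
  rw [hgoal]
  have g1 := (gU' 1 (by norm_num)).trans hII
  have g2 := (gU' 2 (by norm_num)).trans hII
  have g3 := gUsum.trans hII
  have g4 := gV'.trans hII
  have g5 := gS4'.trans hII
  linarith [tU1, tU2, tS4, tV, tU, e1, e2, e3, e4, e5, f1, f2, f3, f4, f5, g1, g2, g3, g4, g5]

end Summit.Parity.GeneralizedHardyLittlewood.Theorems.GoldbachHeathBrownDispersionHeathBrownMorozUniform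

end
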